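import Mathlib
import HarnessLib
import HarnessLib.Audit
import Summits.RiemannHypothesis.Statement
import Summits.RiemannHypothesis.RiemannHypothesis.Theorems.Splittings.ScrewLatticeThinWall
import HarnessLib.Audit.Status.Attr

/-!
Route: ScrewLasso

# Route ScrewLasso — X-13 LASSO — origin-centred wall-free circles at fine lattice steps plus CEIL
give RH, via total aliased charge sign-definite as h → 0⁺

D-0145 LINE of seat rh-idea-1 (technique: splitting / criterion search; bears_on LADDER-RH rung S-P
«search for NEW splits (screw §19 ff.)»,
column SCREW §19–20). It suffices to show X = X-13: LassoFlux ∧ ChargeContinuity ∧ LassoFine ∧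
CeilAll ⟹ RH, where the PROVABLE content is
two RH-free theorems: `LassoFlux` — for every step h > 0, under CEIL(h), if the origin's component
Ω₀ of 𝔻 ∖ closure(aliasedPoleSet h)
contains origin-centred circles |z| = r with r → 1 (a LASSO around the whole aliased pole field),
then the TOTAL ALIASED CHARGE
Q(h) = Σ_ρ discWeight(c_ρ, u_ρ, 0, 1) = Σ_{Re ρ ≠ 1/2} (c_ρ/2)·e^{−|Re ρ−1/2|h ∓ iγh} vanishes
(global flux + Tannery r → 1); and
`ChargeContinuity` — if Q(h_n) = 0 along steps h_n → 0⁺ then RH, because Q(h) → Σ_{Re ρ ≠ 1/2} c_ρ/2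
whose real part is a sum of
STRICTLY NEGATIVE terms (`re_coeff_neg`): at infinitely fine step all phases align and the global
charge is sign-definite. The zero-side
conjunct `LassoFine` («lassos at arbitrarily fine steps»; RH-implied, proved in the seat's
Sketch3.lean `lassoFine_of_rh`) and the declared
RESIDUAL `CeilAll` (CEIL(h) for every h > 0; RH-implied, `latticeCeiling_of_rh`) complete the split
RH ⟺ CeilAll ∧ LassoFine. Nothing here
bears on the truth of RH.
Lean: `Summit.RiemannHypothesis.RiemannHypothesis.Theses.ScrewLasso.LassoFlux →
Summit.RiemannHypothesis.RiemannHypothesis.Theses.ScrewLasso.ChargeContinuity →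
Summit.RiemannHypothesis.RiemannHypothesis.Theses.ScrewLasso.LassoFine →
Summit.RiemannHypothesis.RiemannHypothesis.Theses.ScrewLasso.CeilAll → Summit.RiemannHypothesis`

## Assembly
Pure logic, kernel-checked in the seat folder (Sketch3.lean `assembly_holds`, 4 lines, rc 0): apply
ChargeContinuity; given δ > 0, LassoFine
yields a step h ∈ (0, δ) with lassos; CeilAll gives CEIL(h); LassoFlux gives Q(h) = 0. The deciding
theorem is `closes (h₁ h₂ h₃ h₄) (hA :
Assembly) := hA h₁ h₂ h₃ h₄`; the Assembly item is PROVABLE NOW (proof text attached as evidence at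
birth).

Rationale: WHY THIS LINE. Mechanism: every existing screw split works LOCALLY at one aliased pole p (X-9
isolated pole, g16/X-10 small free circles around p, X-11 a
wall-free Zoretti cycle around p, X-12 a porous corridor to p) and pays with the fibre charge C_p ≠
0; this line works GLOBALLY: one lasso
|z| = r ⊂ Ω₀ encloses the whole pole field inside radius r, flux quantisation
(`ScrewBorelFlux.circleIntegral_term`, `hasSum_circleIntegral_borel`,
pattern of `ScrewLatticeThinWall.tsum_discWeight_eq_zero_of_latticeCeiling`, here with centre 0 and
radius up to 1) gives Σ_{|q|<r} charge = 0,
Tannery r → 1 gives Q(h) = 0, and the NEW input is the lattice-step limit h → 0⁺, where Q(h) → ½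
Σ_{off-line} c_ρ is sign-definite — no
per-pole access, no cancellation problem among complex phases. Imported: residue calculus / Tannery
(Mathlib `circleIntegral`,
`tendsto_tsum_of_dominated_convergence`) and the ζ-dictionary of Suzuki's screw function
(Suzuki2023, tree `latticeGF_eq_borel`); Borel-series
background Ross–Shapiro doi:10.1090/ulect/025
[corpus:book:ross2002-generalized-analytic-continuation p33]. What it does that listed routes do
not: the conjunct is 1-dimensional RADIAL data — wall-free circle at radius e^{−th} ⟺ the deviation
level t is not in the closure of
{|Re ρ − 1/2| : ρ off-line}, plus «no ring of folded far zeros cuts 0 off» — so for each fixed step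
CC(h) ⟹ Lasso(h) and TW(h) ⟹ Lasso(h)
(a length-zero wall has Lebesgue-null radial shadow and cannot separate), while Lasso allows arcs
and other continua that kill TD/TW; it is
incomparable with X-11 (DustWall) and X-12 (PorousPole) and strictly generalises the per-step rows
X-9/X-10 along fine steps. Negatives index:
nothing refuted concerns aliased poles, discWeight or LatticeCeiling.

RANKED CRUXES. #2 LassoFlux (crux) — RH-free theorem about ζ (provable content, part 1). For every h
> 0 with CEIL(h): if for every δ > 0 there is r ∈ (1 − δ, 1) with the circle |z| = r contained in
the connected component of 0 in 𝔻 ∖ closure(aliasedPoleSet h), then the total aliased charge Σ_ρ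
discWeight (coeff ρ) (mult h ρ) 0 1 vanishes. [difficulty: M] (why it might fail: The tree's flux
identity is stated for radii R ≤ (1−‖p‖)/2 only; centre 0 with R → 1 needs the pole/circle
separation δ ≤ 1 − R re-derived per radius, and the Tannery step r → 1 needs the indicator
discWeight(·,0,r) → discWeight(·,0,1) handled at ‖u‖ = 1 (on-line zeros: both sides 0).)
[corpus:book:ross2002-generalized-analytic-continuation p33, doi:10.1090/ulect/025, Suzuki2023]
#3 LassoFine (crux) — The zero-side conjunct «LASSOS AT FINE STEPS» (the searchable object): for
every δ > 0 there is a step h ∈ (0, δ) such that for every η > 0 some circle |z| = r, r ∈ (1 − η,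
1), lies in the connected component of 0 in 𝔻 ∖ closure(aliasedPoleSet h). In zero language: at that
step the deviation levels t = −log r / h avoid the closure of {|Re ρ − 1/2| : ρ off-line} along t →
0⁺ (RADIAL GAPS) and no ring of folded far zeros e^{∓(ρ−1/2)h} separates 0 from those circles (NO
RING). RH-implied (empty field; Sketch3 `lassoFine_of_rh`). [difficulty: open-problem] (why it might
fail: False iff ¬RH and at every fine step either the off-line deviations |Re ρ − 1/2| are dense
near 0 (circles all hit the wall) or rings of folded far zeros (phases γh mod 2π dense on a level)
cut 0 off — exactly the B14/B16/B16′ blind-model geometry; ζ-side nothing is known.)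
[corpus:book:ross2002-generalized-analytic-continuation p33, doi:10.1090/ulect/025]
#4 ChargeContinuity (crux) — RH-free theorem (provable content, part 2; pure summability +
sign-definiteness): if along steps h → 0⁺ the total aliased charge Σ_ρ discWeight (coeff ρ) (mult h
ρ) 0 1 vanishes, then RH. Proof sketch: for h > 0 the ρ-term is 𝟙[Re ρ > 1/2](c_ρ/2)e^{−(ρ−1/2)h} +
𝟙[Re ρ < 1/2](c_ρ/2)e^{(ρ−1/2)h}, dominated by ‖c_ρ‖ (summable, `summable_norm_coeff`), tending to
𝟙[Re ρ ≠ 1/2]·c_ρ/2; Tannery gives Σ_{off-line} c_ρ/2 = 0, whose real part is a sum of strictly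
negative terms (`re_coeff_neg`) — so there is no off-line zero. [difficulty: S] (why it might fail:
Only Lean cost: the indicator bookkeeping ‖mult h ρ‖ < 1 ⟺ Re ρ < 1/2 for h > 0 (`norm_mult`),
Tannery along a sequence, re/tsum exchange, and the transfer «every non-trivial zero has Re = 1/2 ⟹
RiemannHypothesis» (pattern in `rh_of_latticeCeiling_of_countableClosure`).) [Suzuki2023,
corpus:book:ross2002-generalized-analytic-continuation p33]
#9 CeilAll (support) — RESIDUAL conjunct (declared, NOT attacked; RH-strength inside the real-weight
zero-side class by the blind models B14/B16/B16′): CEIL(h) = LatticeCeiling h for EVERY step h > 0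
(equivalently for all h below any fixed ε, since CEIL(h/m) ⟹ CEIL(h)). RH ⟹ CeilAll
(`latticeCeiling_of_rh`, Sketch3 `ceilAll_of_rh`). [difficulty: open-problem] [Suzuki2023,
corpus:book:ross2002-generalized-analytic-continuation p33]

TWO-LAYER PLAN. LassoFlux ⇐ (F1) flux through an origin-centred wall-free circle of any radius r < 1
inside Ω₀: Σ_ρ discWeight (coeff ρ) (mult h ρ) 0 r = 0
(the tree's `tsum_discWeight_eq_zero` freed from R ≤ (1−‖p‖)/2) → (F2) Tannery r → 1⁻ → LassoFlux.
ChargeContinuity ⇐ (C1) Tannery h → 0⁺ →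
(C2) sign argument + RH transfer. Nothing filed now.

KILL CRITERIA. A refutation of LassoFlux or ChargeContinuity (both claimed RH-free theorems) closes
the route `refuted:<Decl>` — either would expose an error in
the flux/Tannery bookkeeping, informative for the whole §20 column. A refutation of LassoFine is
¬RH-type information (impossible to obtain
unconditionally); a proof that LassoFine follows from a classical zero-density statement would
upgrade the row. If X-10/X-11/X-12 close, this
line is not mooted (its conjunct is incomparable with TD and PorousPole and weaker than TW
step-wise).

NOT DECOMPOSED YET. (F1)/(F2)/(C1)/(C2) above are layer-2 children for the provers; the comparison
lemmas CC(h) ⟹ Lasso(h), TW(h) ⟹ Lasso(h) (radial shadow of a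
length-zero wall is Lebesgue-null; a totally disconnected compact set does not separate) are
remarks, not items.

CHEAPEST FALSIFIER. (i) Costume/tautology: `#h21_crux_probe` with summit := Summit.RiemannHypothesis
on LassoFlux / LassoFine / ChargeContinuity / CeilAll (run
before filing, verdicts in the seat folder bc/probe3.out). (ii) The h → 0⁺ limit: check by hand that
for h > 0 the indicator ‖mult h ρ‖ < 1 is
EXACTLY «Re ρ < 1/2» (`norm_mult`: ‖u_ρ‖ = e^{(Re ρ − 1/2)h}) — done; on-line zeros contribute 0 at
every h > 0, so the limit is the off-line
sum only. (iii) Instrument row that would refute the conjunct: an atlas of hypothetical off-line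
zeros whose deviations |Re ρ − 1/2| are dense
near 0, or whose ordinates make γh mod 2π dense on a deviation level for every fine h (a ring) — the
B16′ one-circle divisor wall
(`ScrewLatticeWolffModel.exists_blind_model_discrete`) is the kernel-side picture of exactly that
obstruction.

NUMBERS. Aliased poles satisfy e^{−h/2} ≤ ‖p‖ < 1 (`exp_neg_half_le_norm_of_mem`); the lasso radii r
→ 1 are at fixed h (quantifier order ∃ h ∀ η ∃ r),
so the trivial pole-free disc |z| < e^{−h/2} never suffices; no hand-picked thresholds (checklist
4c(iv)).

DEFINITION REQUESTS. None (`discWeight`, `coeff`, `mult`, `aliasedPoleSet`, `LatticeCeiling` are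
tree decls; `connectedComponentIn`, `Metric.sphere` Mathlib).

Novelty: Searches (2026-08-27): lit search --hybrid "Borel series sum of residues vanishes analytic
continuation unit disc circles total charge" (6 docs: resurgence/summability books, none on
Wolff–Denjoy series flux); lit search --hybrid "Suzuki screw function nontrivial zeros lattice
generating function explicit formula cosh" (5 docs, none relevant); lit galaxy search "Borel
series|Wolff-Denjoy|Denjoy-Wolff series" --star all (16 metadata rows, generic complex-analysis
texts, e.g. [galaxy:panama:321624330993675] Gamelin); earlier this session: lit read
book:ross2002-generalized-analytic-continuation (Wolff p33, Bonsall p36, BSZ p37),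
[galaxy:panama:357169480335412].
Nearest prior art found: tree `ScrewLatticeThinWall.tsum_discWeight_eq_zero_of_latticeCeiling` (flux
quantisation for small circles, §20) and Ross–Shapiro doi:10.1090/ulect/025 ch. 4
(Borel/Wolff–Denjoy series: non-continuation criteria are local-density conditions at the poles).
Delta: replaces every per-pole access condition by ONE global lasso plus the lattice-step limit h →
0⁺, at which the total aliased charge becomes sign-definite — a new RH-free pair (LassoFlux,
ChargeContinuity) and a 1-dimensional radial conjunct (deviation-level gaps + no ring) incomparable
with TD/porosity and weaker than TW/CC step-wise.
Claimed grade: new-combination  [refs: 10.1090/ulect/025, book:ross2002-generalized-analytic-continuation, doi:10.1090/ulect/025]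

Barriers (technique_class: splitting, criterion-search, borel-continuation): - technique_class: splitting, criterion-search, borel-continuation
- Literature.Barriers.RiemannHypothesis.DavenportHeilbronn: outside — no zero-free region is claimed
and the RH-free theorems run through ζ's own explicit-formula dictionary (`latticeGF_eq_borel`,
Suzuki2023); for a Davenport–Heilbronn function CEIL fails generically, so its off-line zeros
contradict nothing here.
- Literature.Barriers.RiemannHypothesis.BrouckeDebruyneRevesz2023_thm13: outside (Beurling-type
counterexamples) — no Euler product / Beurling-prime input is used; LassoFlux and ChargeContinuity
are statements about one fixed sign-definite ℓ¹ Borel family.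
- Literature.Barriers.RiemannHypothesis.BohrDenseValues: outside — no value-distribution input; the
invisibility results that DO bear on this class are the tree blind models B14/B16/B16′
(`ScrewLatticeWolffModel.exists_blind_model`, `exists_blind_model_discrete`), honoured: CEIL stays a
declared residual, and every known blind wall contains a ring (a full circle of accumulation), which
is exactly what LassoFine excludes — the conjunct is consistent with, not refuted by, the models.
- Negatives index: none of stmt-RiemannHypothesis-15969/15970/16980/2575 or the screw-neg landed
negatives (PivotFloor, LogFloorTail, ZeroDeficitTail, quadratic-form floors, uniform diagonal
margin) concerns aliased poles, discWeight or LatticeCeiling; nothing refuted is re-wanted.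

sub-problem: RiemannHypothesis · status: draft · opened planner-rh-idea-1-g0-0 2026-08-27T20:41:36Z · rev 0 · ledger route-RiemannHypothesis-ScrewLasso
GENERATED by the gate from the ledger (D-0016/17). Provers cite these decls: `theorem foo : Summit.RiemannHypothesis.RiemannHypothesis.Theses.ScrewLasso.<Decl> := …` in Summits/RiemannHypothesis/RiemannHypothesis/Theorems/<Name>.lean.
-/

namespace Summit.RiemannHypothesis.RiemannHypothesis.Theses.ScrewLasso

open scoped BigOperators Topology Manifold Classical MeasureTheory ProbabilityTheory Matrix InnerProductSpace ComplexConjugate ContinuousMap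
open Filter Set Function TopologicalSpace MeasureTheory

attribute [summit_statement] _root_.Summit.RiemannHypothesis

open Summit

/-- item stmt-RiemannHypothesis-22291 · crux · rank 2 · closed · proved by Summit.RiemannHypothesis.RiemannHypothesis.Theorems.Splittings.ScrewLassoFlux.lassoFlux_proof (prover) · by planner
why it might fail: The tree's flux identity is stated for radii R ≤ (1−‖p‖)/2 only; centre 0 with R → 1 needs the pole/circle separation δ ≤ 1 − R re-derived per radius, and the Tannery step r → 1 needs the indicator discWeight(·,0,r) → discWeight(·,0,1) handled at ‖u‖ = 1 (on-line zeros: both sides 0).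
sources: corpus:book:ross2002-generalized-analytic-continuation p33, doi:10.1090/ulect/025, Suzuki2023
[crux] RH-free theorem about ζ (provable content, part 1). For every h > 0 with CEIL(h): if for
every δ > 0 there is r ∈ (1 − δ, 1) with the circle |z| = r contained in the connected component of
0 in 𝔻 ∖ closure(aliasedPoleSet h), then the total aliased charge Σ_ρ discWeight (coeff ρ) (mult h
ρ) 0 1 vanishes. [difficulty: M] -/
@[route_item "route-RiemannHypothesis-ScrewLasso", crux]
def LassoFlux : Prop :=
  ∀ h : ℝ, 0 < h → Theorems.Splittings.ScrewLatticeContinuation.LatticeCeiling h → (∀ δ : ℝ, 0 < δ → ∃ r ∈ Set.Ioo (1 - δ) 1, Metric.sphere (0 : ℂ) r ⊆ connectedComponentIn (Metric.ball (0 : ℂ) 1 \ closure (Theorems.Splittings.ScrewLatticeContinuation.aliasedPoleSet h)) 0) → ∑' ρ : Literature.NumberTheory.LFunctions.ZetaZeros.riemannZetaNontrivialZeros, Theorems.Splittings.ScrewBorelFlux.discWeight (Theorems.Splittings.ScrewLatticeContinuation.coeff ρ) (Theorems.Splittings.ScrewLatticeContinuation.mult h ρ) 0 1 = 0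

-- `LassoFlux` holds: proved by `Summit.RiemannHypothesis.RiemannHypothesis.Theorems.Splittings.ScrewLassoFlux.lassoFlux_proof` (its module imports this route file, so no `_holds` link can be stated here).

/-- item stmt-RiemannHypothesis-22292 · crux · rank 3 · open · by planner
why it might fail: False iff ¬RH and at every fine step either the off-line deviations |Re ρ − 1/2| are dense near 0 (circles all hit the wall) or rings of folded far zeros (phases γh mod 2π dense on a level) cut 0 off — exactly the B14/B16/B16′ blind-model geometry; ζ-side nothing is known.
sources: corpus:book:ross2002-generalized-analytic-continuation p33, doi:10.1090/ulect/025
[crux] The zero-side conjunct «LASSOS AT FINE STEPS» (the searchable object): for every δ > 0 there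
is a step h ∈ (0, δ) such that for every η > 0 some circle |z| = r, r ∈ (1 − η, 1), lies in the
connected component of 0 in 𝔻 ∖ closure(aliasedPoleSet h). In zero language: at that step the
deviation levels t = −log r / h avoid the closure of {|Re ρ − 1/2| : ρ off-line} along t → 0⁺
(RADIAL GAPS) and no ring of folded far zeros e^{∓(ρ−1/2)h} separates 0 from those circles (NO
RING). RH-implied (empty field; Sketch3 `lassoFine_of_rh`). [difficulty: open-problem] -/
@[route_item "route-RiemannHypothesis-ScrewLasso", crux]
def LassoFine : Prop :=
  ∀ δ : ℝ, 0 < δ → ∃ h ∈ Set.Ioo 0 δ, ∀ η : ℝ, 0 < η → ∃ r ∈ Set.Ioo (1 - η) 1, Metric.sphere (0 : ℂ) r ⊆ connectedComponentIn (Metric.ball (0 : ℂ) 1 \ closure (Theorems.Splittings.ScrewLatticeContinuation.aliasedPoleSet h)) 0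

/-- item stmt-RiemannHypothesis-22293 · crux · rank 4 · closed · proved by Summit.RiemannHypothesis.RiemannHypothesis.Theorems.Splittings.ScrewLassoCharge.chargeContinuity_proof (prover) · by planner
why it might fail: Only Lean cost: the indicator bookkeeping ‖mult h ρ‖ < 1 ⟺ Re ρ < 1/2 for h > 0 (`norm_mult`), Tannery along a sequence, re/tsum exchange, and the transfer «every non-trivial zero has Re = 1/2 ⟹ RiemannHypothesis» (pattern in `rh_of_latticeCeiling_of_countableClosure`).
sources: Suzuki2023, corpus:book:ross2002-generalized-analytic-continuation p33
[crux] RH-free theorem (provable content, part 2; pure summability + sign-definiteness): if along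
steps h → 0⁺ the total aliased charge Σ_ρ discWeight (coeff ρ) (mult h ρ) 0 1 vanishes, then RH.
Proof sketch: for h > 0 the ρ-term is 𝟙[Re ρ > 1/2](c_ρ/2)e^{−(ρ−1/2)h} + 𝟙[Re ρ <
1/2](c_ρ/2)e^{(ρ−1/2)h}, dominated by ‖c_ρ‖ (summable, `summable_norm_coeff`), tending to 𝟙[Re ρ ≠
1/2]·c_ρ/2; Tannery gives Σ_{off-line} c_ρ/2 = 0, whose real part is a sum of strictly negative
terms (`re_coeff_neg`) — so there is no off-line zero. [difficulty: S] -/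
@[route_item "route-RiemannHypothesis-ScrewLasso", crux]
def ChargeContinuity : Prop :=
  (∀ δ : ℝ, 0 < δ → ∃ h ∈ Set.Ioo 0 δ, ∑' ρ : Literature.NumberTheory.LFunctions.ZetaZeros.riemannZetaNontrivialZeros, Theorems.Splittings.ScrewBorelFlux.discWeight (Theorems.Splittings.ScrewLatticeContinuation.coeff ρ) (Theorems.Splittings.ScrewLatticeContinuation.mult h ρ) 0 1 = 0) → _root_.RiemannHypothesis

-- `ChargeContinuity` holds: proved by `Summit.RiemannHypothesis.RiemannHypothesis.Theorems.Splittings.ScrewLassoCharge.chargeContinuity_proof` (its module imports this route file, so no `_holds` link can be stated here).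

/-- item stmt-RiemannHypothesis-22294 · support · rank 9 · open · by planner
sources: Suzuki2023, corpus:book:ross2002-generalized-analytic-continuation p33
[support] RESIDUAL conjunct (declared, NOT attacked; RH-strength inside the real-weight zero-side
class by the blind models B14/B16/B16′): CEIL(h) = LatticeCeiling h for EVERY step h > 0
(equivalently for all h below any fixed ε, since CEIL(h/m) ⟹ CEIL(h)). RH ⟹ CeilAll
(`latticeCeiling_of_rh`, Sketch3 `ceilAll_of_rh`). [difficulty: open-problem] -/
@[route_item "route-RiemannHypothesis-ScrewLasso", crux]
def CeilAll : Prop :=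
  ∀ h : ℝ, 0 < h → Theorems.Splittings.ScrewLatticeContinuation.LatticeCeiling h

/-- item stmt-RiemannHypothesis-22295 · assembly · rank 1 · closed · proved by Summit.RiemannHypothesis.RiemannHypothesis.Theorems.ScrewLasso.assembly_proof (prover) · by planner
sources: Suzuki2023
[assembly] LassoFlux → ChargeContinuity → LassoFine → CeilAll → RH (provable now; proof =
Sketch3.lean `assembly_holds`). -/
@[route_item "route-RiemannHypothesis-ScrewLasso", crux]
def Assembly : Prop :=
  LassoFlux → ChargeContinuity → LassoFine → CeilAll → Summit.RiemannHypothesis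

-- `Assembly` holds: proved by `Summit.RiemannHypothesis.RiemannHypothesis.Theorems.ScrewLasso.assembly_proof` (its module imports this route file, so no `_holds` link can be stated here).

/-! D-0027 §2.1 — DECIDING THEOREM (planner-authored via `route open/edit --closes-file`; by planner-rh-idea-1-g0-0 2026-08-27T20:41:36Z):
its hypotheses are this route's items and its conclusion the sub-problem Statement (glue_lint), and it elaborates with this file. -/

@[closes "route-RiemannHypothesis-ScrewLasso"] theorem closes (h₁ : LassoFlux) (h₂ : ChargeContinuity) (h₃ : LassoFine) (h₄ : CeilAll) (hA : Assembly) :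
    Summit.RiemannHypothesis := hA h₁ h₂ h₃ h₄

end Summit.RiemannHypothesis.RiemannHypothesis.Theses.ScrewLasso
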